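import Summits.QuantumFields.BalabanUV.T4Continuum.Support.NE7K1LinSchurKernelDecay

/-!
# NE7K1LinSchurKernelDecayLine — row NE7 (node U5), candidate route HOM, path H1L, cell K1-lin(s): THE WHOLE TWO-CUTOFF LINE'S SYMBOL
# `σ_s = (1−s)P_A + s·K_L` IS EXPONENTIALLY LOCALISED AT ONE SCALE, UNIFORMLY IN `s ∈ [0,1]` AND IN THE MESH (U = 1, A = 0)

Lineage `b2b-balaban-t4-ne7-p2` (CRUX PROVER NE7 #2), generation 71; file 29 — a corollary sheet of file 28 (`NE7K1LinSchurKernelDecay`).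
PRICING-NE7 v28's desk note N-28-1 books, for NEEDS-ESTIMATE #E1 «REG-LINE(s)», the operator `−D_s = (1−s)(−Δ^{η_A}) + s·K_L` on the `η_A`
lattice (translation-invariant; class S of lens 2).  At `a = 0` the tree's two-cutoff line `twoCutoffLine … n 0 s = (1−s)·P_A + s·K_L`
(`NE7K1LinSchurLineForm.lineOpR`; `P_A = runA n L 0 R′ = n²·(Neumann Laplacian)` has range one — `runA_apply_eq_zero_of_far`) and file 28's
`twoCutoffLine_one_entry_decay` localises `K_L`; hence **`twoCutoffLine_entry_decay`**: for `θ ≥ 0` with `16(d+1)²L^{d+3}(e^θ − 1) ≤ 1`,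
`0 ≤ s ≤ 1` and coarse sites at sup-distance `≥ 2`, `|σ_s(x,y)| ≤ n²·64(d+1)²·9^{d+1}·L^{d+5}·e^{−θ(|x − y|_∞ − 2)}` — rate and
prefactor∕n² free of the mesh AND of `s`.

HONEST FRAMING: [folklore]; a two-lemma corollary; ONE scale, A = 0, U = 1, crude constants; the per-scale iteration (#E1's input along the
block-RG trajectory) is NOT here; nothing of Bałaban's asserted; no `sorry`.  Census only (#E1 stays OPEN; cell K1-lin(s) TAG ∕ SIZE per
PRICING-NE7 v28 unchanged); NE7 NOT PRINTED ∕ NOT PROVED; spine 0∕9; FIXED FINITE T⁴, rung (B)+1; NOT infinite volume, NOT mass gap, NOT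
Clay.  HONEST DEPENDENCY: continuum YM on T⁴ ⇐ BetaPertH ∧ nine spine estimates (0/9 proved); BetaPertH ⇐ (D1) ∧ (D4) ∧ CAP+tail; G-an2-4
gates asym, D1 and NE2/3/4.
-/

noncomputable section

open Finset Matrix

namespace Summit.QuantumFields.BalabanUV.T4Continuum.NE7K1LinSchurKernelDecayLine

open Literature.MathematicalPhysics.QuantumFieldTheory.Balaban1983to89
open Literature.MathematicalPhysics.QuantumFieldTheory.Balaban1983to89.B4ContourShift (supNorm)
open Literature.MathematicalPhysics.QuantumFieldTheory.Balaban1983to89.B4Reflection242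
open Literature.MathematicalPhysics.QuantumFieldTheory.Balaban1983to89.B4BoxCov237
open Literature.MathematicalPhysics.QuantumFieldTheory.Balaban1983to89.B4Lower18
open NE7K1LinBlockCoords NE7K1LinSchurLineU1 NE7K1LinSchurLineForm NE7K1LinWalkLine NE7K1LinSchurKernelDecay

variable {d : ℕ} {n L : ℕ} {R' : Finset (Fin (d + 1) → ℤ)}

/-- at `a = 0`, run A's operator `P_A = n²·(Neumann Laplacian of R′.image (blk L))` has range one: `P_A(x,y) = 0` unless `|x − y|_∞ ≤ 1`.
[folklore] -/
theorem runA_apply_eq_zero_of_far (x y : ↥(R'.image (blk L))) (hfar : ¬ ∀ μ, |x.1 μ - y.1 μ| ≤ 1) :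
    runA n L (0 : ℝ) R' x y = 0 := by
  classical
  have hxy : x ≠ y := fun h => hfar (by intro μ; rw [h]; simp)
  have hnb : y.1 ∉ nbrs x.1 := fun h => hfar (cubeAdj_of_eq_or_mem_nbrs (Or.inr h))
  have hyx : y ≠ x := Ne.symm hxy
  simp [runA, fineOpR, regionOpR, Matrix.of_apply, neumannLapR, diagK, avgK, hyx, hnb]

variable [NeZero L]

/-- **THE TWO-CUTOFF LINE'S SYMBOL IS EXPONENTIALLY LOCALISED AT ONE SCALE, UNIFORMLY IN `s ∈ [0,1]` AND IN THE MESH**: at `a = 0`,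
`σ_s = twoCutoffLine … n 0 s = (1−s)·P_A + s·K_L` satisfies, for `θ ≥ 0` with `16(d+1)²L^{d+3}(e^θ − 1) ≤ 1`, `0 ≤ s ≤ 1` and coarse
sites at sup-distance `≥ 2`, `|σ_s(x,y)| ≤ n²·64(d+1)²·9^{d+1}·L^{d+5}·e^{−θ(|x − y|_∞ − 2)}` (PRICING-NE7 v28 N-28-1's class-S symbol at
scale one; `NE7K1LinSchurKernelDecay.twoCutoffLine_one_entry_decay` for `K_L`, `runA_apply_eq_zero_of_far` for `P_A`). [folklore] -/
theorem twoCutoffLine_entry_decay (hn : 1 ≤ n) (hR' : IsBlockUnion (n * L) R') {θ : ℝ} (hθ : 0 ≤ θ)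
    (hθs : 16 * ((d : ℝ) + 1) ^ 2 * (L : ℝ) ^ (d + 3) * (Real.exp θ - 1) ≤ 1) {s : ℝ} (hs0 : 0 ≤ s) (hs1 : s ≤ 1)
    (x y : ↥(R'.image (blk L))) (hfar : ¬ ∀ μ, |x.1 μ - y.1 μ| ≤ 1) :
    |twoCutoffLine (isBlockUnion_fine hR') n (0 : ℝ) s x y| ≤
      (n : ℝ) ^ 2 * (64 * ((d : ℝ) + 1) ^ 2 * (9 : ℝ) ^ (d + 1) * (L : ℝ) ^ (d + 5)) *
        Real.exp (-(θ * (supNorm (x.1 - y.1) - 2))) := by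
  have hK := twoCutoffLine_one_entry_decay hn hR' hθ hθs x y hfar
  have heq : twoCutoffLine (isBlockUnion_fine hR') n (0 : ℝ) s x y =
      (1 - s) * runA n L (0 : ℝ) R' x y + s * twoCutoffLine (isBlockUnion_fine hR') n (0 : ℝ) 1 x y := by
    simp only [twoCutoffLine, lineOpR, Matrix.add_apply, Matrix.smul_apply, Matrix.sub_apply, smul_eq_mul, sub_self, zero_mul,
      one_mul, zero_add]
  rw [heq, runA_apply_eq_zero_of_far x y hfar, mul_zero, zero_add, abs_mul, abs_of_nonneg hs0]
  calc s * |twoCutoffLine (isBlockUnion_fine hR') n (0 : ℝ) 1 x y|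
      ≤ 1 * |twoCutoffLine (isBlockUnion_fine hR') n (0 : ℝ) 1 x y| := mul_le_mul_of_nonneg_right hs1 (abs_nonneg _)
    _ ≤ _ := by rw [one_mul]; exact hK

end Summit.QuantumFields.BalabanUV.T4Continuum.NE7K1LinSchurKernelDecayLine

end
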